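import Summits.CriticalPhenomena.PercolationContinuityZ3.Theorems.FK.PressureBetaDerivative
import Literature.Probability.LatticeModels.SourcedDoubleCurrentsSwitchingProofs
import HarnessLib

/-!
# NO LATENT HEAT: `ψ(·,0)` IS `C¹` IN `β` ON `(0, β_c]` — INCLUDING AT `β_c` — WITH `∂ψ/∂β = Σᵢ ⟨σ_0σ_{eᵢ}⟩_β`, AND EVERY
# CORRELATION `β ↦ ⟨σ_A⟩^{∅/+}_β` IS CONTINUOUS ON `(0, β_c]`
# (Lebowitz 1977, Thm. 2; Aizenman–Duminil-Copin–Sidoravicius 2015, Thm. 1.2: `m*(β_c) = 0` ⇒ uniqueness at `β_c`)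

Claimed R42 (8)(c) in the cell INBOX at 2026-08-29T00:59:05Z by fkp-10a gen 357 (NEW CLAIM #1 of the gen), addressed to coordinator fk-4 (next seated gen; gen 284 CLOSED l.8632; (ι) in force for windows); lineage row FO-10a-g357 (self-suggested), package g357-energy, label EB-C.
Helper file of the `fk-continuity` build cell (bschramm lane; `--supports stmt-CriticalPhenomena-4575`); builds on
p205010 (kernel theorem, internal audit signed; external expert review pending). No definitions, no named facts, no
sorries; standard axioms. UNCONDITIONAL (nearest-neighbour Ising model on `ℤ^d` at zero field, `d ≥ 2`).

For `d ≥ 2` and `0 ≤ β ≤ β_c(d)` the free and plus states agree on all spin products (tree theorem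
`freeCorr_eq_plusCorr_of_le_criticalBeta`: below `β_c` by the definition of `β_c` and Lebowitz–Martin-Löf; AT `β_c`
because `m*(β_c) = 0` — Aizenman–Duminil-Copin–Sidoravicius 2015 for `d ≥ 3`, Onsager–Yang for `d = 2`, tree theorem
`spontaneousMagnetization_eq_zero_of_le_criticalBeta_two_le`). With the one-sided `β`-derivatives of
`PressureBetaDerivative` (`∂⁺ψ/∂β = Σᵢ ⟨σ_0σ_{eᵢ}⟩⁺_β`, `∂⁻ψ/∂β = Σᵢ ⟨σ_0σ_{eᵢ}⟩^∅_β`) and the one-sided continuities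
of the two states in `β` (`⟨·⟩⁺` right-continuous, `⟨·⟩^∅` left-continuous):

* **`continuousAt_plusCorr_of_le_criticalBeta`**, **`continuousAt_freeCorr_of_le_criticalBeta`** — for every finite `A`
  and every `0 < β ≤ β_c(d)`, `b ↦ ⟨σ_A⟩⁺_{b,0}` and `b ↦ ⟨σ_A⟩^∅_{b,0}` are CONTINUOUS at `β` (two-sided; at `β_c` the
  left limit of the plus state is the free state at `β_c`, which is the plus state at `β_c`);
* **`hasDerivAt_pressure_beta_of_le_criticalBeta`** — for `0 < β ≤ β_c(d)`: `HasDerivAt ψ(·,0) (Σᵢ ⟨σ_0σ_{eᵢ}⟩⁺_β) β`;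
  in particular **`hasDerivAt_pressure_beta_criticalBeta`** — **THE PRESSURE IS DIFFERENTIABLE IN `β` AT `β_c`: THE
  ISING TRANSITION HAS NO LATENT HEAT** (the energy density `Σᵢ ⟨σ_0σ_{eᵢ}⟩_β` is continuous at `β_c`,
  `continuousAt_sum_plusCorr_nn_criticalBeta`);
* `deriv_pressure_beta_of_le_criticalBeta`, **`continuousOn_deriv_pressure_beta_Ioc`** — `ψ(·,0) ∈ C¹((0, β_c])`:
  `deriv ψ(·,0) = Σᵢ ⟨σ_0σ_{eᵢ}⟩⁺` on `(0, β_c]`, a continuous function there; `differentiableOn_pressure_beta_Ioc`.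

(Above `β_c` the derivative exists off a countable set — `countable_not_differentiableAt_pressure_beta` — and at every
`β` where `m*` is left-continuous: `PressureBetaCoexistence`.)

## References

* J. L. Lebowitz, *Coexistence of phases in Ising ferromagnets*, J. Stat. Phys. 16 (1977) 463–476, §3, Thm. 2,
  p. 470. [Lebowitz1977]
* M. Aizenman, H. Duminil-Copin, V. Sidoravicius, *Random currents and continuity of Ising model's spontaneous
  magnetization*, Comm. Math. Phys. 334 (2015) 719–742, Thm. 1.2, Cor. 1.5, §3.3. [AizenmanDuminilCopinSidoraviciusCMP2015]
* S. Friedli, Y. Velenik, *Statistical Mechanics of Lattice Systems*, CUP (2017), Thm. 3.25, Thm. 3.28, Exercise 3.17,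
  note [11] to p. 335. [FriedliVelenik2017]
-/

noncomputable section

namespace Summit.CriticalPhenomena.PercolationContinuityZ3.Theorems.FK

namespace IsingEnergyDensity

open MeasureTheory Filter Topology Finset Set
open Literature.Probability.LatticeModels
open Summit.CriticalPhenomena.PercolationContinuityZ3.Theorems.FK.ConcaveLimit

variable {d : ℕ}

/-! ### Continuity of all correlations in `β` on `(0, β_c]` -/

/-- **For `d ≥ 2`, `0 < β ≤ β_c(d)` and every finite `A`, `b ↦ ⟨σ_A⟩⁺_{b,0}` is continuous at `β`**: right-continuous
always (`plusCorr_continuousWithinAt_Ici`); on `(0, β]` it coincides with the left-continuous `b ↦ ⟨σ_A⟩^∅_{b,0}`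
(`freeCorr_eq_plusCorr_of_le_criticalBeta`, `freeCorr_continuousWithinAt_Iic`).
[cite: AizenmanDuminilCopinSidoraviciusCMP2015, Thm. 1.2 and §3.3; FriedliVelenik2017, Exercise 3.17] -/
theorem continuousAt_plusCorr_of_le_criticalBeta (hd : 2 ≤ d) {β : ℝ} (hβ : 0 < β) (hβc : β ≤ criticalBeta d)
    (A : Finset (Site d)) : ContinuousAt (fun b => plusCorr d b 0 A) β := by
  refine continuousAt_iff_continuous_left_right.2 ⟨?_, plusCorr_continuousWithinAt_Ici le_rfl A hβ.le⟩
  refine (freeCorr_continuousWithinAt_Iic (d := d) le_rfl A hβ).congr_of_eventuallyEq ?_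
    (freeCorr_eq_plusCorr_of_le_criticalBeta hd hβ.le hβc A).symm
  filter_upwards [Ioc_mem_nhdsLE hβ] with b hb
  exact (freeCorr_eq_plusCorr_of_le_criticalBeta hd hb.1.le (hb.2.trans hβc) A).symm

/-- **For `d ≥ 2`, `0 < β ≤ β_c(d)` and every finite `A`, `b ↦ ⟨σ_A⟩^∅_{b,0}` is continuous at `β`**: left-continuous
always; from the right it is squeezed, `⟨σ_A⟩^∅_β ≤ ⟨σ_A⟩^∅_b ≤ ⟨σ_A⟩⁺_b → ⟨σ_A⟩⁺_β = ⟨σ_A⟩^∅_β` (GKS monotonicity,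
`⟨·⟩^∅ ≤ ⟨·⟩⁺`, right-continuity of the plus state, uniqueness at `β ≤ β_c`).
[cite: AizenmanDuminilCopinSidoraviciusCMP2015, Thm. 1.2 and §3.3; FriedliVelenik2017, Exercise 3.16] -/
theorem continuousAt_freeCorr_of_le_criticalBeta (hd : 2 ≤ d) {β : ℝ} (hβ : 0 < β) (hβc : β ≤ criticalBeta d)
    (A : Finset (Site d)) : ContinuousAt (fun b => freeCorr d b 0 A) β := by
  refine continuousAt_iff_continuous_left_right.2 ⟨freeCorr_continuousWithinAt_Iic le_rfl A hβ, ?_⟩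
  have hplus : Tendsto (fun b => plusCorr d b 0 A) (𝓝[Ici β] β) (𝓝 (freeCorr d β 0 A)) := by
    rw [freeCorr_eq_plusCorr_of_le_criticalBeta hd hβ.le hβc A]
    exact (plusCorr_continuousWithinAt_Ici (d := d) le_rfl A hβ.le).tendsto
  refine tendsto_of_tendsto_of_tendsto_of_le_of_le' tendsto_const_nhds hplus ?_ ?_
  · filter_upwards [self_mem_nhdsWithin] with b hb
    exact freeCorr_mono_params hβ.le hb le_rfl le_rfl A
  · filter_upwards [self_mem_nhdsWithin] with b hb
    exact freeCorr_le_plusCorr (hβ.le.trans hb) le_rfl A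

/-- **The plus nearest-neighbour energy `b ↦ Σᵢ ⟨σ_0σ_{eᵢ}⟩⁺_b` is continuous at every `0 < β ≤ β_c(d)`** (`d ≥ 2`).
[cite: AizenmanDuminilCopinSidoraviciusCMP2015, Thm. 1.2; Lebowitz1977, §3, Thm. 2] -/
theorem continuousAt_sum_plusCorr_nn_of_le_criticalBeta (hd : 2 ≤ d) {β : ℝ} (hβ : 0 < β)
    (hβc : β ≤ criticalBeta d) : ContinuousAt (fun b => ∑ i, plusCorr d b 0 {0, Pi.single i 1}) β :=
  tendsto_finsetSum _ fun i _ => (continuousAt_plusCorr_of_le_criticalBeta hd hβ hβc {0, Pi.single i 1}).tendsto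

/-- **The free nearest-neighbour energy `b ↦ Σᵢ ⟨σ_0σ_{eᵢ}⟩^∅_b` is continuous at every `0 < β ≤ β_c(d)`** (`d ≥ 2`).
[cite: AizenmanDuminilCopinSidoraviciusCMP2015, Thm. 1.2; Lebowitz1977, §3, Thm. 2] -/
theorem continuousAt_sum_freeCorr_nn_of_le_criticalBeta (hd : 2 ≤ d) {β : ℝ} (hβ : 0 < β)
    (hβc : β ≤ criticalBeta d) : ContinuousAt (fun b => ∑ i, freeCorr d b 0 {0, Pi.single i 1}) β :=
  tendsto_finsetSum _ fun i _ => (continuousAt_freeCorr_of_le_criticalBeta hd hβ hβc {0, Pi.single i 1}).tendsto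

/-- **THE ENERGY DENSITY IS CONTINUOUS AT `β_c`** (`d ≥ 2`): `b ↦ Σᵢ ⟨σ_0σ_{eᵢ}⟩⁺_b` is continuous at `β_c(d)` — no latent
heat at the Curie point. [cite: AizenmanDuminilCopinSidoraviciusCMP2015, Thm. 1.2 and Cor. 1.5; Lebowitz1977, §3, Thm. 2] -/
theorem continuousAt_sum_plusCorr_nn_criticalBeta (hd : 2 ≤ d) :
    ContinuousAt (fun b => ∑ i, plusCorr d b 0 {0, Pi.single i 1}) (criticalBeta d) :=
  continuousAt_sum_plusCorr_nn_of_le_criticalBeta hd (criticalBeta_pos_holds hd) le_rfl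

/-! ### `ψ(·,0)` is differentiable on `(0, β_c]`, including at `β_c` -/

/-- **For `d ≥ 2` and `0 < β ≤ β_c(d)`, `ψ(·,0)` is differentiable at `β` with `∂ψ/∂β (β,0) = Σᵢ ⟨σ_0σ_{eᵢ}⟩⁺_β`**
(`= Σᵢ ⟨σ_0σ_{eᵢ}⟩^∅_β`: the free and plus states coincide). [cite: Lebowitz1977, §3, Thm. 2, p. 470; AizenmanDuminilCopinSidoraviciusCMP2015, Thm. 1.2] -/
theorem hasDerivAt_pressure_beta_of_le_criticalBeta (hd : 2 ≤ d) {β : ℝ} (hβ : 0 < β) (hβc : β ≤ criticalBeta d) :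
    HasDerivAt (fun b => pressure d b 0) (∑ i, plusCorr d β 0 {0, Pi.single i 1}) β :=
  hasDerivAt_pressure_beta_of_nn_freeCorr_eq_plusCorr hβ fun _ =>
    freeCorr_eq_plusCorr_of_le_criticalBeta hd hβ.le hβc _

/-- **NO LATENT HEAT AT `β_c` — THE PRESSURE OF THE NEAREST-NEIGHBOUR ISING MODEL ON `ℤ^d` (`d ≥ 2`) IS DIFFERENTIABLE
IN `β` AT THE CRITICAL POINT**, with `∂ψ/∂β (β_c,0) = Σᵢ ⟨σ_0σ_{eᵢ}⟩⁺_{β_c} = Σᵢ ⟨σ_0σ_{eᵢ}⟩^∅_{β_c}`: the phase transition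
at `β_c` is continuous in the energy as well as in the magnetisation (`m*(β_c) = 0`, Aizenman–Duminil-Copin–Sidoravicius).
[cite: AizenmanDuminilCopinSidoraviciusCMP2015, Thm. 1.2 and Cor. 1.5; Lebowitz1977, §3, Thm. 2, p. 470] -/
theorem hasDerivAt_pressure_beta_criticalBeta (hd : 2 ≤ d) :
    HasDerivAt (fun b => pressure d b 0) (∑ i, plusCorr d (criticalBeta d) 0 {0, Pi.single i 1}) (criticalBeta d) :=
  hasDerivAt_pressure_beta_of_le_criticalBeta hd (criticalBeta_pos_holds hd) le_rfl

/-- `ψ(·,0)` is differentiable at every `β ∈ (0, β_c(d)]` (`d ≥ 2`). [cite: Lebowitz1977, §3, Thm. 2, p. 470] -/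
theorem differentiableAt_pressure_beta_of_le_criticalBeta (hd : 2 ≤ d) {β : ℝ} (hβ : 0 < β)
    (hβc : β ≤ criticalBeta d) : DifferentiableAt ℝ (fun b => pressure d b 0) β :=
  (hasDerivAt_pressure_beta_of_le_criticalBeta hd hβ hβc).differentiableAt

/-- `deriv ψ(·,0) β = Σᵢ ⟨σ_0σ_{eᵢ}⟩⁺_β` for `β ∈ (0, β_c(d)]` (`d ≥ 2`). [cite: Lebowitz1977, §3, Thm. 2, p. 470] -/
theorem deriv_pressure_beta_of_le_criticalBeta (hd : 2 ≤ d) {β : ℝ} (hβ : 0 < β) (hβc : β ≤ criticalBeta d) :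
    deriv (fun b => pressure d b 0) β = ∑ i, plusCorr d β 0 {0, Pi.single i 1} :=
  (hasDerivAt_pressure_beta_of_le_criticalBeta hd hβ hβc).deriv

/-- The free form: `deriv ψ(·,0) β = Σᵢ ⟨σ_0σ_{eᵢ}⟩^∅_β` for `β ∈ (0, β_c(d)]` (`d ≥ 2`).
[cite: Lebowitz1977, §3, Thm. 2, p. 470] -/
theorem deriv_pressure_beta_eq_sum_freeCorr_nn_of_le_criticalBeta (hd : 2 ≤ d) {β : ℝ} (hβ : 0 < β)
    (hβc : β ≤ criticalBeta d) :
    deriv (fun b => pressure d b 0) β = ∑ i, freeCorr d β 0 {0, Pi.single i 1} := by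
  rw [deriv_pressure_beta_of_le_criticalBeta hd hβ hβc]
  exact sum_congr rfl fun i _ => (freeCorr_eq_plusCorr_of_le_criticalBeta hd hβ.le hβc _).symm

/-- `ψ(·,0)` is differentiable on `(0, β_c(d)]` (`d ≥ 2`). [cite: Lebowitz1977, §3, Thm. 2, p. 470] -/
theorem differentiableOn_pressure_beta_Ioc (hd : 2 ≤ d) :
    DifferentiableOn ℝ (fun b => pressure d b 0) (Ioc 0 (criticalBeta d)) := fun _ hβ =>
  (differentiableAt_pressure_beta_of_le_criticalBeta hd hβ.1 hβ.2).differentiableWithinAt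

/-- **`ψ(·,0) ∈ C¹((0, β_c])`** (`d ≥ 2`): `deriv ψ(·,0)`, equal to the energy `Σᵢ ⟨σ_0σ_{eᵢ}⟩⁺` on `(0, β_c(d)]`, is
continuous there — up to and including `β_c`. [cite: Lebowitz1977, §3, Thm. 2, p. 470; AizenmanDuminilCopinSidoraviciusCMP2015, Thm. 1.2] -/
theorem continuousOn_deriv_pressure_beta_Ioc (hd : 2 ≤ d) :
    ContinuousOn (deriv fun b => pressure d b 0) (Ioc 0 (criticalBeta d)) := by
  have hc : ContinuousOn (fun b => ∑ i, plusCorr d b 0 {0, Pi.single i 1}) (Ioc 0 (criticalBeta d)) :=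
    fun β hβ => (continuousAt_sum_plusCorr_nn_of_le_criticalBeta hd hβ.1 hβ.2).continuousWithinAt
  exact hc.congr fun β hβ => deriv_pressure_beta_of_le_criticalBeta hd hβ.1 hβ.2

/-- **The energy is nondecreasing and continuous on `(0, β_c]` and the pressure is its integral there in chord form**:
for `d ≥ 2` and `0 < β' < β ≤ β_c(d)`, `Σᵢ ⟨σ_0σ_{eᵢ}⟩_{β'} ≤ (ψ(β,0) − ψ(β',0))/(β − β') ≤ Σᵢ ⟨σ_0σ_{eᵢ}⟩_β` with the
COMMON (free = plus) energy at both ends. [cite: Lebowitz1977, §3, proof of Thm. 2, p. 470] -/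
theorem slope_pressure_beta_mem_Icc_of_le_criticalBeta (hd : 2 ≤ d) {β' β : ℝ} (hβ' : 0 < β') (hlt : β' < β)
    (hβc : β ≤ criticalBeta d) :
    slope (fun b => pressure d b 0) β' β ∈
      Icc (∑ i, plusCorr d β' 0 {0, Pi.single i 1}) (∑ i, plusCorr d β 0 {0, Pi.single i 1}) := by
  refine ⟨sum_plusCorr_nn_le_slope_pressure_beta hβ'.le hlt, ?_⟩
  have h := slope_pressure_beta_le_sum_freeCorr_nn (d := d) (hβ'.le.trans hlt.le) hlt
  rwa [sum_congr rfl fun i _ => freeCorr_eq_plusCorr_of_le_criticalBeta hd (hβ'.le.trans hlt.le) hβc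
    ({0, Pi.single i 1} : Finset (Site d))] at h

end IsingEnergyDensity

end Summit.CriticalPhenomena.PercolationContinuityZ3.Theorems.FK

end
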